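import Literature.Geometry.Kaehler.ComplexTorusSingularPontryaginDuality
import Literature.Geometry.Kaehler.ComplexTorusPontryaginProduct
import HarnessLib

/-!
# `H_•(X, ℤ) ≅ ⋀^• Λ` as rings: the singular-homology Pontryagin ring of a complex torus IS the model

Topic `Literature/Geometry/Kaehler` (complex tori `X = E/Φ(ℤ^ι)`, `Literature.Geometry.Kaehler.ComplexTorus`).
The lane's foundations model the homology of `X` with its Pontryagin product as the exterior algebra of
the lattice, `H_p(X, ℤ) := ⋀ᵖ Λ`, `Λ = ℤ^ι = H₁(X, ℤ)`, `⋆ :=` exterior multiplication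
(`ComplexTorusPontryaginProduct.lean`: `pontryagin`, `latCycle u = e_{u 0} ∧ ⋯ ∧ e_{u (p-1)}`). This file proves
that the model is (canonically isomorphic to) GENUINE singular homology with the GENUINE Pontryagin product
`μ_* ∘ ×` (`singularHomology.addPontryagin`, built in `HomologyCrossProduct.lean` / `PontryaginProduct.lean`):

* `homologyModelEquiv Φ k : Hₖ₊₁(X; ℤ) ≃ₗ[ℤ] ⋀[ℤ]^(k+1) (ι → ℤ)` (singular homology → model), determined by
  `homologyModelEquiv_latticePontryaginMonomial`: **`h(λ_{w 0}) ⋆ ⋯ ⋆ h(λ_{w k}) ↦ λ_w = e_{w 0} ∧ ⋯ ∧ e_{w k}`**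
  for EVERY word `w` (`h(λ_{e_b}) = hOneBasis Φ ℤ b` the Hurewicz image of the lattice vector `e_b`); in
  degree one `h(λ_{e_b}) ↦ e_b` (`homologyModelEquiv_hOneBasis`);
* `coe_homologyModelEquiv_addPontryagin`: **it is multiplicative — `Ψ(σ ⋆ τ) = Ψ(σ) ∧ Ψ(τ)`** in the
  exterior algebra `⋀^• Λ` (Lange 2023, §2.5.3 with Exercise 1.1.6 (11)–(12): under `H_•(X, ℤ) = ⋀^• H₁(X, ℤ)`
  the Pontryagin product is the exterior product);
* `span_latCycle_eq_top`: the lattice cycles `λ_w` span `⋀ᵖ Λ`.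

(The model-side duality `D : ⋀ᵖ Λ → {integral invariant forms}` and its multiplicativity are
`ComplexTorusPontryaginDuality.lean`; the singular-side `D` is `ComplexTorusSingularPontryaginDuality.lean`.)

Everything is proved; the only definitions (with bodies) are `homologyToModel` and `homologyModelEquiv`; no
named fact.

## References

* [Lange2023AbelianVarietiesComplex] H. Lange, *Abelian Varieties over the Complex Numbers* (2023),
  §2.5.3 pp. 132–134 (Pontryagin product, Lemma 2.5.11, Lemma 2.5.12); §1.1.3 Exercise 1.1.6 (8), (11), (12).
* [HatcherAT2002] A. Hatcher, *Algebraic Topology* (2002), §3.2 Example 3.16, §3.B, §3.C.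
-/

noncomputable section

open CategoryTheory Module
open Literature.AlgebraicTopology.SingularHomology Literature.AlgebraicTopology

universe u

namespace Literature.Geometry.Kaehler

namespace ComplexTorus

/- The generic `AddCommGroup.toIntModule` competes with `Submodule.module` for `Module ℤ ↥(⋀[ℤ]^n (ι → ℤ))`
(the two are equal, even definitionally, but not reducibly so); which one instance search returns depends
on the import order, and with the generic one Mathlib's `exteriorPower.instFree` / `finrank_eq` /
`ιMulti_span_of_span` do not apply syntactically. As in `ComplexTorusIntegralExteriorAlgebra.lean` we
switch the generic instance off in this file; the `ℤ`-module structures used below are then the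
structural ones (`Submodule.module` on the model, `ModuleCat` on singular homology), and integer
multiples `c • x` of homology classes are the `zsmul` of the additive group as everywhere in this series. -/
attribute [-instance] AddCommGroup.toIntModule

/-! ### The lattice cycles span the model -/

section Span

variable {ι : Type} [Fintype ι] [DecidableEq ι]

/-- **The lattice cycles `λ_w = e_{w 0} ∧ ⋯ ∧ e_{w (p-1)}` span `⋀ᵖ ℤ^ι`** (decomposable vectors in a basis
span the exterior power). [cite: Lange2023AbelianVarietiesComplex, §2.5.3 Lemma 2.5.12 (p. 133)] -/
theorem span_latCycle_eq_top (p : ℕ) :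
    Submodule.span ℤ (Set.range fun u : Fin p → ι ↦ latCycle u) = ⊤ := by
  rw [eq_top_iff, ← exteriorPower.ιMulti_span_of_span ℤ p (M := ι → ℤ) (Pi.basisFun ℤ ι).span_eq, Submodule.span_le]
  rintro _ ⟨a, ha, rfl⟩
  choose u hu using fun j ↦ ha ⟨j, rfl⟩
  have hau : a = fun j ↦ (Pi.single (u j) (1 : ℤ) : ι → ℤ) := funext fun j ↦ by rw [← hu j, Pi.basisFun_apply]
  subst hau
  exact Submodule.subset_span ⟨u, rfl⟩

omit [Fintype ι] in
/-- `λ_{w∘σ} = sign σ · λ_w` with an integer scalar. [cite: Lange2023AbelianVarietiesComplex, §2.5.3 Lemma 2.5.11] -/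
theorem latCycle_comp_perm_zsmul {p : ℕ} (u : Fin p → ι) (σ : Equiv.Perm (Fin p)) :
    latCycle (u ∘ σ) = ((Equiv.Perm.sign σ : ℤˣ) : ℤ) • latCycle u := by
  rw [latCycle_comp_perm, Units.smul_def]

/-- The lattice cycle of a concatenated word, in the exterior algebra: `λ_{e e'} = λ_e · λ_{e'}`.
[cite: Lange2023AbelianVarietiesComplex, §2.5.3 (p. 133)] -/
theorem coe_latCycle_appendWord {k l m : ℕ} (h : k + 1 + (l + 1) = m + 1) (e : Fin (k + 1) → ι) (e' : Fin (l + 1) → ι) :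
    ((latCycle ((Fintype.equivFin ι).symm ∘ appendWord (Fintype.equivFin ι ∘ e) (Fintype.equivFin ι ∘ e') m h) :
        ⋀[ℤ]^(m + 1) (ι → ℤ)) : ExteriorAlgebra ℤ (ι → ℤ)) =
      ((latCycle e : ⋀[ℤ]^(k + 1) (ι → ℤ)) : ExteriorAlgebra ℤ (ι → ℤ)) * ((latCycle e' : ⋀[ℤ]^(l + 1) (ι → ℤ)) : _) := by
  rw [← coe_pontryagin, pontryagin_latCycle, latCycle_eq, latCycle_eq, exteriorPower.ιMulti_apply_coe,
    exteriorPower.ιMulti_apply_coe, ExteriorAlgebra.ιMulti_apply, ExteriorAlgebra.ιMulti_apply, List.ofFn_congr h.symm]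
  congr 2
  funext i
  simp only [Function.comp_apply]
  congr 2
  refine Fin.addCases (fun j ↦ ?_) (fun j ↦ ?_) i
  · have hj : ((Fin.cast h.symm.symm (Fin.castAdd (l + 1) j) : Fin (m + 1)) : ℕ) < k + 1 := j.2
    rw [Fin.append_left, appendWord_apply_of_lt _ _ h _ hj, Function.comp_apply, Equiv.symm_apply_apply]
    congr 1
  · have hj : k + 1 ≤ ((Fin.cast h.symm.symm (Fin.natAdd (k + 1) j) : Fin (m + 1)) : ℕ) := Nat.le_add_right _ _
    rw [Fin.append_right, appendWord_apply_of_le _ _ h _ hj, Function.comp_apply, Equiv.symm_apply_apply]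
    congr 1
    exact Fin.ext (Nat.add_sub_cancel_left _ _)

end Span

variable {ι : Type} [Fintype ι] [DecidableEq ι] {E : Type} [NormedAddCommGroup E] [NormedSpace ℂ E]
variable (Φ : (ι → ℝ) ≃L[ℝ] E)

/-! ### The comparison map -/

/-- The comparison map `Hₖ₊₁(X; ℤ) → ⋀ᵏ⁺¹ Λ`: the basis monomial `h(λ_{s₀}) ⋆ ⋯ ⋆ h(λ_{sₖ})` goes to
`e_{s₀} ∧ ⋯ ∧ e_{sₖ}`. [cite: Lange2023AbelianVarietiesComplex, §2.5.3 (pp. 132–133); Exercise 1.1.6 (12)] -/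
def homologyToModel (k : ℕ) : singularHomology ℤ ℤ (ComplexTorus Φ) (k + 1) →ₗ[ℤ] ⋀[ℤ]^(k + 1) (ι → ℤ) :=
  (singularHomologyIntBasis Φ k).constr ℤ fun s ↦ latCycle ((Fintype.equivFin ι).symm ∘ subsetEmb s)

/-- Value on the basis. [cite: Lange2023AbelianVarietiesComplex, §2.5.3 (pp. 132–133)] -/
theorem homologyToModel_singularHomologyIntBasis (k : ℕ) (s : Set.powersetCard (Fin (Fintype.card ι)) (k + 1)) :
    homologyToModel Φ k (singularHomologyIntBasis Φ k s) = latCycle ((Fintype.equivFin ι).symm ∘ subsetEmb s) :=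
  Module.Basis.constr_basis _ _ _ _

/-- **`h(λ_{w 0}) ⋆ ⋯ ⋆ h(λ_{w k}) ↦ e_{w 0} ∧ ⋯ ∧ e_{w k}` for EVERY word `w`** (both sides vanish on
repeated letters and pick up `sign σ` under permutations). [cite: Lange2023AbelianVarietiesComplex, §2.5.3 Lemma 2.5.11, Lemma 2.5.12 (pp. 132–133)] -/
theorem homologyToModel_latticePontryaginMonomial (k : ℕ) (w : Fin (k + 1) → ι) :
    homologyToModel Φ k (latticePontryaginMonomial Φ k w) = latCycle w := by
  by_cases hw : Function.Injective w
  · obtain ⟨s, σ, hs⟩ := exists_eq_subsetEmb_comp_perm ((Fintype.equivFin ι).injective.comp hw)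
    have hw' : w = ((Fintype.equivFin ι).symm ∘ subsetEmb s) ∘ σ := by
      funext i
      have := congrFun hs i
      simp only [Function.comp_apply] at this ⊢
      rw [← this, Equiv.symm_apply_apply]
    rw [hw', latticePontryaginMonomial_comp_perm, map_zsmul, ← singularHomologyIntBasis_apply,
      homologyToModel_singularHomologyIntBasis, latCycle_comp_perm_zsmul]
  · rw [latticePontryaginMonomial_eq_zero_of_not_injective Φ hw, map_zero, latCycle_of_not_injective hw]

/-- In degree one: `h(λ_{e_b}) ↦ e_b`. [cite: Lange2023AbelianVarietiesComplex, §2.5.3 (p. 133)] -/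
theorem homologyToModel_hOneBasis (b : ι) :
    homologyToModel Φ 0 (hOneBasis Φ ℤ b) = latCycle (fun _ : Fin 1 ↦ b) := by
  rw [← homologyToModel_latticePontryaginMonomial Φ 0, latticePontryaginMonomial_zero]

/-- The comparison map is onto (the lattice cycles span the model). [cite: Lange2023AbelianVarietiesComplex, §2.5.3 Lemma 2.5.12 (p. 133)] -/
theorem homologyToModel_surjective (k : ℕ) : Function.Surjective (homologyToModel Φ k) := by
  rw [← LinearMap.range_eq_top, eq_top_iff, ← span_latCycle_eq_top (ι := ι) (k + 1), Submodule.span_le]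
  rintro _ ⟨u, rfl⟩
  exact ⟨latticePontryaginMonomial Φ k u, homologyToModel_latticePontryaginMonomial Φ k u⟩

omit [DecidableEq ι] in
/-- `rank_ℤ ⋀ᵏ⁺¹ ℤ^ι = C(|ι|, k+1) = rank_ℤ Hₖ₊₁(X; ℤ)`. [cite: Lange2023AbelianVarietiesComplex, §1.1.3 Exercise 1.1.6 (8) (held p0027 L13)] -/
theorem finrank_exteriorPower_eq_finrank_singularHomology (k : ℕ) :
    finrank ℤ (⋀[ℤ]^(k + 1) (ι → ℤ)) = finrank ℤ (singularHomology ℤ ℤ (ComplexTorus Φ) (k + 1)) := by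
  rw [exteriorPower.finrank_eq, finrank_fintype_fun_eq_card, finrank_singularHomology_int]

/-- The comparison map is bijective (onto, between free `ℤ`-modules of the same finite rank).
[cite: Lange2023AbelianVarietiesComplex, §2.5.3 Lemma 2.5.12 (p. 133)] -/
theorem homologyToModel_bijective (k : ℕ) : Function.Bijective (homologyToModel Φ k) := by
  refine ⟨?_, homologyToModel_surjective Φ k⟩
  let θ : (⋀[ℤ]^(k + 1) (ι → ℤ)) ≃ₗ[ℤ] singularHomology ℤ ℤ (ComplexTorus Φ) (k + 1) :=
    LinearEquiv.ofFinrankEq _ _ (finrank_exteriorPower_eq_finrank_singularHomology Φ k)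
  have hF : Function.Injective (homologyToModel Φ k ∘ₗ θ.toLinearMap) :=
    OrzechProperty.injective_of_surjective_endomorphism _ ((homologyToModel_surjective Φ k).comp θ.surjective)
  intro x y hxy
  have := @hF (θ.symm x) (θ.symm y) (by simpa using hxy)
  simpa using this

/-- **`Hₖ₊₁(X; ℤ) ≅ ⋀ᵏ⁺¹ Λ`: singular homology of the complex torus with its Pontryagin monomials IS the
lane's exterior-algebra model** (`h(λ_{w 0}) ⋆ ⋯ ⋆ h(λ_{w k}) ↦ e_{w 0} ∧ ⋯ ∧ e_{w k}`).
[cite: Lange2023AbelianVarietiesComplex, §2.5.3 (pp. 132–134); §1.1.3 Exercise 1.1.6 (8), (12)] -/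
def homologyModelEquiv (k : ℕ) : singularHomology ℤ ℤ (ComplexTorus Φ) (k + 1) ≃ₗ[ℤ] ⋀[ℤ]^(k + 1) (ι → ℤ) :=
  LinearEquiv.ofBijective (homologyToModel Φ k) (homologyToModel_bijective Φ k)

/-- Unfolding. [cite: Lange2023AbelianVarietiesComplex, §2.5.3 (pp. 132–134)] -/
@[simp]
theorem homologyModelEquiv_apply (k : ℕ) (x : singularHomology ℤ ℤ (ComplexTorus Φ) (k + 1)) :
    homologyModelEquiv Φ k x = homologyToModel Φ k x := rfl

/-- **`Ψ(h(λ_{w 0}) ⋆ ⋯ ⋆ h(λ_{w k})) = e_{w 0} ∧ ⋯ ∧ e_{w k}`.** [cite: Lange2023AbelianVarietiesComplex, §2.5.3 (pp. 132–134)] -/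
theorem homologyModelEquiv_latticePontryaginMonomial (k : ℕ) (w : Fin (k + 1) → ι) :
    homologyModelEquiv Φ k (latticePontryaginMonomial Φ k w) = latCycle w :=
  homologyToModel_latticePontryaginMonomial Φ k w

/-- **`Ψ(h(λ_{e_b})) = e_b`** (degree one: the Hurewicz class of the lattice vector `e_b` goes to `e_b`).
[cite: Lange2023AbelianVarietiesComplex, §2.5.3 (p. 133)] -/
theorem homologyModelEquiv_hOneBasis (b : ι) :
    homologyModelEquiv Φ 0 (hOneBasis Φ ℤ b) = latCycle (fun _ : Fin 1 ↦ b) :=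
  homologyToModel_hOneBasis Φ b

/-! ### Multiplicativity: `Ψ(σ ⋆ τ) = Ψ σ ∧ Ψ τ` -/

/-- Every class is an integral combination of the basis monomials (with integer scalars).
[cite: Lange2023AbelianVarietiesComplex, Exercise 1.1.6 (12) (held p0028 L29)] -/
theorem eq_sum_zsmul_latticePontryaginMonomial (k : ℕ) (x : singularHomology ℤ ℤ (ComplexTorus Φ) (k + 1)) :
    x = ∑ s : Set.powersetCard (Fin (Fintype.card ι)) (k + 1),
      ((singularHomologyIntBasis Φ k).repr x s) • latticePontryaginMonomial Φ k ((Fintype.equivFin ι).symm ∘ subsetEmb s) := by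
  conv_lhs => rw [← (singularHomologyIntBasis Φ k).sum_repr x]
  refine Finset.sum_congr rfl fun s _ ↦ ?_
  rw [singularHomologyIntBasis_apply]
  exact int_smul_eq_zsmul _ _ _

omit [Fintype ι] [DecidableEq ι] in
/-- `⋆` commutes with integer multiples on the left. [cite: Lange2023AbelianVarietiesComplex, §2.5.3 (p. 132)] -/
theorem addPontryagin_zsmul_left {p q r : ℕ} (hpq : p + q = r) (c : ℤ) (u : singularHomology ℤ ℤ (ComplexTorus Φ) p)
    (v : singularHomology ℤ ℤ (ComplexTorus Φ) q) :
    singularHomology.addPontryagin ℤ (ComplexTorus Φ) hpq (c • u) v = c • singularHomology.addPontryagin ℤ (ComplexTorus Φ) hpq u v :=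
  map_zsmul (AddMonoidHom.mk' (fun u : singularHomology ℤ ℤ (ComplexTorus Φ) p ↦
    singularHomology.addPontryagin ℤ (ComplexTorus Φ) hpq u v) fun a b ↦ by rw [map_add, LinearMap.add_apply]) c u

omit [Fintype ι] [DecidableEq ι] in
/-- `⋆` commutes with integer multiples on the right. [cite: Lange2023AbelianVarietiesComplex, §2.5.3 (p. 132)] -/
theorem addPontryagin_zsmul_right {p q r : ℕ} (hpq : p + q = r) (c : ℤ) (u : singularHomology ℤ ℤ (ComplexTorus Φ) p)
    (v : singularHomology ℤ ℤ (ComplexTorus Φ) q) :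
    singularHomology.addPontryagin ℤ (ComplexTorus Φ) hpq u (c • v) = c • singularHomology.addPontryagin ℤ (ComplexTorus Φ) hpq u v :=
  map_zsmul _ c v

omit [Fintype ι] [DecidableEq ι] in
/-- `⋆` commutes with sums on the left. [cite: Lange2023AbelianVarietiesComplex, §2.5.3 (p. 132)] -/
theorem addPontryagin_sum_left {p q r : ℕ} (hpq : p + q = r) {α : Type*} (S : Finset α)
    (u : α → singularHomology ℤ ℤ (ComplexTorus Φ) p) (v : singularHomology ℤ ℤ (ComplexTorus Φ) q) :
    singularHomology.addPontryagin ℤ (ComplexTorus Φ) hpq (∑ a ∈ S, u a) v =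
      ∑ a ∈ S, singularHomology.addPontryagin ℤ (ComplexTorus Φ) hpq (u a) v := by
  rw [map_sum, LinearMap.sum_apply]

/-- **Multiplicativity of the comparison: `Ψ(σ ⋆ τ) = Ψ(σ) ∧ Ψ(τ)`** in `⋀^• Λ ⊆ ExteriorAlgebra ℤ Λ` —
the genuine Pontryagin product `μ_* ∘ ×` on `H_•(X; ℤ)` corresponds to exterior multiplication (Lange
2023, §2.5.3: the Pontryagin product makes `H_•(X, ℤ) = ⋀^• H₁(X, ℤ)`; Exercise 1.1.6 (11)–(12)).
[cite: Lange2023AbelianVarietiesComplex, §2.5.3 (pp. 132–133); Exercise 1.1.6 (11)–(12)] -/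
theorem coe_homologyModelEquiv_addPontryagin {k l m : ℕ} (h : k + 1 + (l + 1) = m + 1)
    (x : singularHomology ℤ ℤ (ComplexTorus Φ) (k + 1)) (y : singularHomology ℤ ℤ (ComplexTorus Φ) (l + 1)) :
    ((homologyModelEquiv Φ m (singularHomology.addPontryagin ℤ (ComplexTorus Φ) h x y) : ⋀[ℤ]^(m + 1) (ι → ℤ)) :
        ExteriorAlgebra ℤ (ι → ℤ)) =
      ((homologyModelEquiv Φ k x : ⋀[ℤ]^(k + 1) (ι → ℤ)) : ExteriorAlgebra ℤ (ι → ℤ)) *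
        ((homologyModelEquiv Φ l y : ⋀[ℤ]^(l + 1) (ι → ℤ)) : ExteriorAlgebra ℤ (ι → ℤ)) := by
  have key : ∀ (e : Fin (k + 1) → ι) (e' : Fin (l + 1) → ι),
      ((homologyModelEquiv Φ m (singularHomology.addPontryagin ℤ (ComplexTorus Φ) h (latticePontryaginMonomial Φ k e)
          (latticePontryaginMonomial Φ l e')) : ⋀[ℤ]^(m + 1) (ι → ℤ)) : ExteriorAlgebra ℤ (ι → ℤ)) =
        ((homologyModelEquiv Φ k (latticePontryaginMonomial Φ k e) : ⋀[ℤ]^(k + 1) (ι → ℤ)) : ExteriorAlgebra ℤ (ι → ℤ)) *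
          ((homologyModelEquiv Φ l (latticePontryaginMonomial Φ l e') : ⋀[ℤ]^(l + 1) (ι → ℤ)) : ExteriorAlgebra ℤ (ι → ℤ)) := by
    intro e e'
    rw [addPontryagin_latticePontryaginMonomial Φ h, homologyModelEquiv_latticePontryaginMonomial,
      homologyModelEquiv_latticePontryaginMonomial, homologyModelEquiv_latticePontryaginMonomial, coe_latCycle_appendWord]
  have key₁ : ∀ (e : Fin (k + 1) → ι) (y : singularHomology ℤ ℤ (ComplexTorus Φ) (l + 1)),
      ((homologyModelEquiv Φ m (singularHomology.addPontryagin ℤ (ComplexTorus Φ) h (latticePontryaginMonomial Φ k e) y) :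
          ⋀[ℤ]^(m + 1) (ι → ℤ)) : ExteriorAlgebra ℤ (ι → ℤ)) =
        ((homologyModelEquiv Φ k (latticePontryaginMonomial Φ k e) : ⋀[ℤ]^(k + 1) (ι → ℤ)) : ExteriorAlgebra ℤ (ι → ℤ)) *
          ((homologyModelEquiv Φ l y : ⋀[ℤ]^(l + 1) (ι → ℤ)) : ExteriorAlgebra ℤ (ι → ℤ)) := by
    intro e y
    rw [eq_sum_zsmul_latticePontryaginMonomial Φ l y]
    simp only [map_sum, map_zsmul, Submodule.coe_sum, SetLike.val_smul, Finset.mul_sum, mul_smul_comm, key]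
  rw [eq_sum_zsmul_latticePontryaginMonomial Φ k x, addPontryagin_sum_left]
  simp only [addPontryagin_zsmul_left]
  simp only [map_sum, map_zsmul, Submodule.coe_sum, SetLike.val_smul, Finset.sum_mul, smul_mul_assoc, key₁]

end ComplexTorus

end Literature.Geometry.Kaehler

end
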